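import Summits.ABC.IUTFork.Cor312StatementBridges
import Summits.ABC.IUTFork.Cor312StatementBridge
import Summits.ABC.IUTFork.Thm311LinkCompat
import HarnessLib

/-!
# The fork at [IUTchIII] Corollary 3.12 — TEAM A gap witness: the typed Theorem 3.11 does not entail the typed Corollary

Record-only file (D-0012) of the abc-iut cell (Cor. 3.12 STRATEGY TEAM A «direct III§3», D-0067, seat
abc-iut-c312-9 = A1, row A-4 of `HOME/plan/C312-TEAMS.md`); TAKES NO SIDE. Team A's charter is to discharge
Cor. 3.12 from the typed Thm. 3.11 (i)–(iii) interfaces as printed, or to isolate the exact non-following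
inference as a typed statement. This file makes the isolation KERNEL-CHECKED at the interface level:

* `gapFull` / `gapSetting` — ONE toy instantiation (over the `ℚ`-packets of `Cor312StatementBridges.Checks`:
  `l⋇ = 2`, one place, nontrivial tensor packets) carrying BOTH a `FullSituation` that satisfies the typed
  **Theorem 3.11 (i) ∧ (ii) ∧ (iii)** (`gapFull_statement`) AND a verbatim `Cor312.Setting` that satisfies
  ALL the bridge hypotheses (`gapSetting_bridgeHyps : BridgeHyps gapSetting` — monotone log-volume,
  admissible possible images, nonempty hull-sets, nonempty Θ-regions, `ThetaFinite`) and the positivity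
  "`|log(q)| > 0`" (`gapSetting_absLogQPos`) — while the typed **Corollary 3.12 FAILS**
  (`gapSetting_not_statement`: `−|log(Θ)| = −2 < −1 = −|log(q)|`).
* `thm311_bridgeHyps_not_imp_statement` — the ∃-form: **granting the typed Theorem 3.11 in full, all bridge
  hypotheses, and `|log(q)| > 0`, the typed Corollary 3.12 still has a countermodel.** So no kernel proof of
  Cor. 3.12 can proceed from these interfaces alone: every derivation must consume an input of the strength
  of the Step (xi) readings (R1 `statement_of_represented` / R2 `…subset_thetaHull` / R3
  `…mem_possibleImages` of `Cor312StatementBridge`, or the weaker R4 `IsoContainment` of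
  `Cor312ReadingIso`) — which is exactly where the printed proof writes "then follows formally"
  ((xi-f), kurims `paper:url-4b091feeb646` p. 184 l. 19–29) and where Scholze–Stix (§2.2) and LANA (§9.2
  (9-1)) locate the dispute. The readings all FAIL in the witness (`gapSetting_not_qRegion_subset_thetaHull`),
  as they must.

HONEST SCOPE. This is an INTERFACE-LEVEL result: it says the typed Thm. 3.11 signature (c312-1's A–D files,
with every hypothesis granted) plus the bridge hypotheses do not CONSTRAIN the two glue maps
(`Setting.thetaRegionOf`, `Setting.qRegionOf`) enough to force the inequality — the witness makes the Θ-pilot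
Kummer image `{0}` and the `q`-pilot image everything. It does NOT say the inequality fails for the INTENDED
instantiation (the assembled real setting of `Cor312SettingReal`, where the glue maps are built from the
actual Kummer isomorphisms): whether a Step (xi) reading is PROVABLE there from the frozen definitions and
the FACT-LIST is precisely Team A's remaining question (the GAP statement, `HOME/plan/GAP-LEDGER.md` when
adjudicated). Sources read on the page: [IUTchIII] pp. 153–159, 173–175, 183–185; Scholze–Stix 2018 §2.2;
LANA §9.2. [claim: Mochizuki2012, status: disputed] [cite: ScholzeStix2018, §2.2 pp. 9–10]
[cite: LANA2026Report, §9.2 p. 46] Deliberately NOT here: any assertion about the real instantiation;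
any judgement on (xi-f).
-/

noncomputable section

namespace Summit.ABC

namespace IUTFork

namespace Cor312Vol

namespace GapWitness

open Thm311 Cor312 Cor312.Checks Literature.IUT.LogThetaLattice

/-! ## 1. The toy packets are nontrivial `ℚ`-lines -/

/-- The fibre of the toy index over its one place is a one-point type. [folklore] -/
@[reducible] def fibreUnique (vQ : toyIndex.VQ) : Unique (toyIndex.Fibre vQ) where
  default := ⟨(), rfl⟩
  uniq := fun a => Subtype.ext (by
    haveI : Subsingleton toyIndex.V := inferInstanceAs (Subsingleton Unit)
    exact Subsingleton.elim _ _)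

/-- The `(j+1)`-tensor packet of the toy log-shells is a `ℚ`-line: every 1-packet is `𝔽ibre → ℚ ≃ ℚ`
(one-point fibre), and the tensor product of the constant family `ℚ` over the capsule `S^±_{j+1} = Fin (j+1)`
is `ℚ` (`PiTensorProduct.constantBaseRingEquiv`). [folklore] -/
def packetEquiv (j : toyIndex.Label) (vQ : toyIndex.VQ) : toyShells.Packet j vQ ≃ₗ[ℚ] ℚ :=
  haveI := fibreUnique vQ
  (PiTensorProduct.congr fun _ : toyIndex.Caps j =>
      LinearEquiv.funUnique (toyIndex.Fibre vQ) ℚ ℚ).trans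
    (PiTensorProduct.constantBaseRingEquiv (toyIndex.Caps j) ℚ).toLinearEquiv

/-- The toy packets are nontrivial (transport of `Nontrivial ℚ` along `packetEquiv`). [folklore] -/
theorem packet_nontrivial (j : toyIndex.Label) (vQ : toyIndex.VQ) :
    Nontrivial (toyShells.Packet j vQ) :=
  (packetEquiv j vQ).symm.injective.nontrivial

/-- The whole packet is NOT contained in `{0}` (it is nontrivial). [folklore] -/
theorem univ_not_subset_zero (j : toyIndex.Label) (vQ : toyIndex.VQ) :
    ¬ (Set.univ : Set (toyShells.Packet j vQ)) ⊆ {0} := by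
  haveI := packet_nontrivial j vQ
  obtain ⟨x, hx⟩ := exists_ne (0 : toyShells.Packet j vQ)
  exact fun h => hx (h (Set.mem_univ x))

/-! ## 2. The data: log-volume `−2` inside `{0}`, `−1` outside — monotone, separating -/

open scoped Classical in
/-- The ONE log-volume function of the gap witness: `−2` on subsets of `{0}`, `−1` elsewhere (shared by the
coric data and the column, so the Kummer clause (ii) (a) holds by `rfl`). [folklore] -/
noncomputable def gapVol (j : toyIndex.Label) (vQ : toyIndex.VQ)
    (A : Set (toyShells.Packet j vQ)) : ℝ :=
  if A ⊆ {0} then -2 else -1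

/-- The gap log-volume of a subset of `{0}` is `−2`. [folklore] -/
theorem gapVol_of_subset {j : toyIndex.Label} {vQ : toyIndex.VQ}
    {A : Set (toyShells.Packet j vQ)} (h : A ⊆ {0}) : gapVol j vQ A = -2 := if_pos h

/-- The gap log-volume of a region not inside `{0}` is `−1`. [folklore] -/
theorem gapVol_of_not_subset {j : toyIndex.Label} {vQ : toyIndex.VQ}
    {A : Set (toyShells.Packet j vQ)} (h : ¬ A ⊆ {0}) : gapVol j vQ A = -1 := if_neg h

/-- Data (a)(b)(c) of the gap witness: everything admissible; the mono-analytic log-volume is `gapVol` —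
monotone (the indicator `A ⊆ {0}` is antitone), and it separates the hull-set `{0}` from the hull-set
`Set.univ`. [folklore] -/
def gapData : MRData toyShells where
  shellPk := fun _ _ => Set.univ
  shellSub := fun _ _ => Set.univ
  Adm := fun _ _ _ => True
  logvol := fun j vQ A => gapVol j vQ A
  Ψ := fun _ _ => ∅
  act := fun _ _ _ => 0
  Mmod := fun _ => ∅

/-- The gap log-volume of a subset of `{0}` is `−2`. [folklore] -/
theorem gapData_logvol_of_subset {j : toyIndex.Label} {vQ : toyIndex.VQ}
    {A : Set (toyShells.Packet j vQ)} (h : A ⊆ {0}) : gapData.logvol j vQ A = -2 :=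
  gapVol_of_subset h

/-- The gap log-volume of a region not inside `{0}` is `−1`. [folklore] -/
theorem gapData_logvol_of_not_subset {j : toyIndex.Label} {vQ : toyIndex.VQ}
    {A : Set (toyShells.Packet j vQ)} (h : ¬ A ⊆ {0}) : gapData.logvol j vQ A = -1 :=
  gapVol_of_not_subset h

/-- The gap log-volume of the whole packet is `−1`. [folklore] -/
theorem gapData_logvol_univ (j : toyIndex.Label) (vQ : toyIndex.VQ) :
    gapData.logvol j vQ Set.univ = -1 := if_neg (univ_not_subset_zero j vQ)

/-- The gap log-volume is monotone on ALL regions (in particular on admissible ones). [folklore] -/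
theorem gapData_logvol_mono {j : toyIndex.Label} {vQ : toyIndex.VQ}
    {A B : Set (toyShells.Packet j vQ)} (hAB : A ⊆ B) :
    gapData.logvol j vQ A ≤ gapData.logvol j vQ B := by
  by_cases hB : B ⊆ {0}
  · rw [gapData_logvol_of_subset (hAB.trans hB), gapData_logvol_of_subset hB]
  · rw [gapData_logvol_of_not_subset hB]
    by_cases hA : A ⊆ {0}
    · rw [gapData_logvol_of_subset hA]; norm_num
    · rw [gapData_logvol_of_not_subset hA]

/-- One Frobenioid object of degree `−1` whose region is everything (so the degree clause of Thm. 3.11 (i)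
(c) holds over the gap log-volume). [folklore] -/
def gapDegrees (j : toyIndex.LabelStar) : GlobalDegrees toyShells j where
  ObjMOD := Unit
  Objmod := Unit
  natIso := Equiv.refl Unit
  deg := fun _ => -1
  region := fun _ _ => Set.univ

/-- The gap situation: the same data on every vertical line. [folklore] -/
def gapSituation : Situation toyIndex where
  L := toyShells
  D := fun _ => gapData
  G := fun _ j => gapDegrees j

/-- A column whose transported data coincide with `gapData` and whose unit images are everything.
[folklore] -/
def gapColumn : Column toyShells where
  frobAdm := fun _ _ _ _ => True
  frobLogvol := fun _ j vQ A => gapVol j vQ A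
  frobΨ := fun _ _ _ => ∅
  frobMmod := fun _ _ => ∅
  unitImage := fun _ _ _ _ => Set.univ
  ballImage := fun _ _ _ => Set.univ
  ObjLGP := Unit
  frobObjLGP := fun _ => Unit
  kumLGP := fun _ => Equiv.refl Unit
  ObjLgp := Unit
  frobObjLgp := fun _ => Unit
  kumLgp := fun _ => Equiv.refl Unit
  thetaPilot := fun _ => ()

/-- Link data over the one-object discrete category (as in c312-1's `Thm311Checks.toyLink`: every
poly-isomorphism full, every induced automorphism the identity). [folklore] -/
def gapLink : LinkData where
  Strip := CategoryTheory.Discrete PUnit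
  Fdelta := fun _ _ => ⟨⟨⟩⟩
  FdeltaD := fun _ => ⟨⟨⟩⟩
  kumDelta := fun _ _ => CategoryTheory.Iso.refl _
  FenvD := fun _ => ⟨⟨⟩⟩
  natEnvD := fun _ => CategoryTheory.Iso.refl _
  Rad := CategoryTheory.Discrete PUnit
  R := fun _ => ⟨⟨⟩⟩
  permR := fun _ => Literature.IUT.HodgeTheaters.PolyIso.full _ _
  Kap := CategoryTheory.Discrete PUnit
  Mk := fun _ => ⟨⟨⟩⟩
  permM := fun _ => Literature.IUT.HodgeTheaters.PolyIso.full _ _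
  AutHT := fun _ _ => Unit
  onDelta := fun _ _ _ => CategoryTheory.Iso.refl _
  onDeltaD := fun _ _ _ => CategoryTheory.Iso.refl _
  onR := fun _ _ _ => CategoryTheory.Iso.refl _
  onM := fun _ _ _ => CategoryTheory.Iso.refl _

/-- The full gap situation. [folklore] -/
def gapFull : FullSituation toyIndex where
  toSituation := gapSituation
  col := fun _ => gapColumn
  link := gapLink

/-! ## 3. The typed Theorem 3.11 holds in the gap witness -/

/-- (i) holds: the splitting monoids are empty, the degree clause reads `−1 = −1`, the classes coincide.
[folklore] -/
theorem gap_partI : gapFull.PartI := by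
  refine ⟨fun n v hv x hx => absurd hx (Set.notMem_empty x), fun n j J => ⟨fun _ => trivial, ?_, ?_⟩,
    fun n n' => rfl⟩
  · haveI : Finite toyIndex.VQ := inferInstanceAs (Finite Unit)
    exact Set.toFinite _
  · show (-1 : ℝ) = ∑ᶠ vQ : toyIndex.VQ, gapData.logvol j.1 vQ Set.univ
    simp only [gapData_logvol_univ]
    rw [finsum_unique]

/-- (ii) holds, column by column: the transported data are literally the coric data. [folklore] -/
theorem gap_partII : gapFull.toLatticeSituation.PartII := by
  intro n
  refine (Column.partII_iff _ _).2 ⟨?_, fun _ _ _ => rfl, fun _ _ => rfl, ?_⟩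
  · intro m j vQ A _; exact ⟨trivial, rfl⟩
  · exact ⟨fun m m' j vQ _ => Set.subset_univ _, fun m j vQ h => absurd trivial h⟩

/-- (iii) holds: the squares of full poly-isomorphisms commute, the stabilizations are free. [folklore] -/
theorem gap_partIII : gapFull.PartIII := by
  refine ⟨gapLink.partIIIa_holds, gapLink.partIIIb_holds, ?_, ?_,
    gapFull.evalCompatUpToInd_of_multiradialCompat gap_partI.2.2⟩
  · refine gapLink.partIIIc_of_full (fun _ => rfl) fun n m => ?_
    rintro p ⟨a, rfl⟩; rfl
  · intro n m; exact Thm311.PolyIsoCalc.stabilized_full _ _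

/-- **The typed Theorem 3.11 (i) ∧ (ii) ∧ (iii) HOLDS in the gap witness.** [folklore] -/
theorem gapFull_statement : gapFull.Statement := ⟨gap_partI, gap_partII, gap_partIII⟩

/-! ## 4. The hull frame `{{0}, univ}` and the setting -/

/-- The hull frame of the gap witness: hull-sets `{0}` and everything (both NONEMPTY — unlike the toy frame
of `Cor312StatementBridges`, whose `∅` hull-set would violate `BridgeHyps.hul_nonempty`); every subset
bounded and admitting a hull. [folklore] -/
def gapFrame (X : Type) [Zero X] : HullFrame X where
  Hul := {{0}, Set.univ}
  IsBounded := fun _ => True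
  HasHull := fun _ => True
  hul_bounded := fun _ _ => trivial
  bounded_mono := fun _ _ _ _ => trivial
  exists_hul := fun _ _ => ⟨Set.univ, Set.mem_insert_of_mem _ rfl, Set.subset_univ _⟩
  hull_mem := fun U _ _ => by
    by_cases hU : U ⊆ {0}
    · have h1 : {H | H ∈ ({{0}, Set.univ} : Set (Set X)) ∧ U ⊆ H} = {{0}, Set.univ} := by
        ext H
        simp only [Set.mem_setOf_eq, Set.mem_insert_iff, Set.mem_singleton_iff, and_iff_left_iff_imp]
        rintro (rfl | rfl)
        · exact hU
        · exact Set.subset_univ _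
      rw [h1]
      have h2 : ⋂₀ ({{0}, Set.univ} : Set (Set X)) = {0} := by
        rw [Set.sInter_pair]
        exact Set.inter_eq_left.mpr (Set.subset_univ _)
      rw [h2]
      exact Set.mem_insert _ _
    · have h1 : {H | H ∈ ({{0}, Set.univ} : Set (Set X)) ∧ U ⊆ H} = {Set.univ} := by
        ext H
        simp only [Set.mem_setOf_eq, Set.mem_insert_iff, Set.mem_singleton_iff]
        constructor
        · rintro ⟨rfl | rfl, hsub⟩
          · exact absurd hsub hU
          · rfl
        · rintro rfl
          exact ⟨Or.inr rfl, Set.subset_univ _⟩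
      rw [h1, Set.sInter_singleton]
      exact Set.mem_insert_of_mem _ rfl

/-- In the gap frame the hull of a set between `{0}` and itself is `{0}`; in particular `hull {0} = {0}`.
[folklore] -/
theorem gapFrame_hull_of_subset {X : Type} [Zero X] {U : Set X} (hU : U ⊆ {0}) :
    (gapFrame X).hull U ⊆ {0} :=
  (gapFrame X).hull_subset_of_mem (Set.mem_insert _ _) hU

/-- The SETTING of the gap witness over `gapSituation`: lattice `^{n,m}𝓗𝓣 := (n, m)`, one-point pilots,
hull frame `gapFrame`; the Θ-pilot Kummer image is `{0}` at every `m` (NONEMPTY, as `BridgeHyps` demands),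
the `q`-pilot image is everything. The glue maps are exactly the data the typed Thm. 3.11 does not
constrain. [folklore] -/
def gapSetting : Setting gapSituation where
  n := 0
  HT := ℤ × ℤ
  LogLink := fun _ _ => Unit
  IsFull := fun _ => True
  lattice :=
    { theater := fun n m => (n, m)
      distinct := fun p q h => by simpa using h
      logLink := fun _ _ => ()
      logLink_full := fun _ _ => trivial }
  Frd := Unit
  IsoF := fun _ _ => Unit
  Ob := fun _ => Unit
  realify := id
  Strip := Unit
  IsoS := fun _ _ => Unit
  M := fun _ _ => Unit
  sig := toySig
  split := { Msplit := fun _ _ => ⊤, exists_gen := fun _ _ => ⟨⟨(), trivial⟩, top_unit_isGenerator _⟩ }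
  ObΔ := Unit
  N := fun _ _ => Unit
  qData := { q := fun _ _ => (), q_gen := fun _ _ => unit_isGenerator _, objOf := fun _ => () }
  frame := fun j vQ => gapFrame _
  hul_adm := fun _ _ _ _ => trivial
  thetaRegionOf := fun _ _ _ _ => {0}
  qRegionOf := fun _ _ _ => Set.univ
  qRegion_mem := fun _ _ => Set.mem_insert_of_mem _ rfl
  qSupport_finite := fun _ => Set.toFinite _


end GapWitness

end Cor312Vol

end IUTFork

end Summit.ABC

end
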